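import Literature.Computability.Cryptography.LWEModulusSwitchSamples
import Literature.Computability.Cryptography.LWENoiseConvolution
import HarnessLib

/-!
# Post-processing torus `LWE` samples: re-randomising the secret and raising the noise rate (exact laws)

Topic `Computability/Cryptography` (LWE), grouping namespace `BLPRS2013`. Proved glue (no named fact)
towards `Literature.Computability.Cryptography.blprs_gapSVP_sqrt_dim_to_lwe_classical` (**pqc.S21**),
hypothesis `h₃` of `BLPRSReduction.lean` — the two textbook sample transformations that follow the modulus
switch of Cor. 3.2 in the reduction: the **random self-reduction of the secret** ("`(a, b) ↦ (a, b + ⟨a, t⟩/q)`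
turns `A_{q,s,φ}` into `A_{q,s+t,φ}` and keeps uniform samples uniform", Regev 2009, Lemma 4.1 (proof:
"a uniform `t`… makes the secret uniform"), used by BLPRS to pass from a binary to a uniform secret) and the
**noise raising** of Regev 2009, Lemma 3.7 / BLPRS 2013, Lemma 2.15 ("adds to the second element of each
sample a noise sampled independently from `Ψ_{√γ}`. This creates … samples from `A_{s,Ψ_{√(β²+γ)}}`"),
as ONE Markov kernel on torus samples `ℤ_qⁿ × 𝕋`:
* `postKernel q τ t (a, b) = law of (a, b + ⟨a, t⟩/q + e)`, `e ← Ψ_τ` (`postOutput` = its action on a law);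
* **`postOutput_uniformInput`** — uniform samples stay uniform (EXACT: Haar measure is translation
  invariant);
* **`postOutput_torusLWESample`** — `A_{q,s,Ψ_σ} ↦ A_{q,s+t,Ψ_{√(σ²+τ²)}}` (EXACT: `⟨a,s⟩/q + ⟨a,t⟩/q ≡ ⟨a,s+t⟩/q
  (mod 1)` and `Ψ_σ ∗ Ψ_τ = Ψ_{√(σ²+τ²)}`, `LWENoiseConvolution.wrappedGaussian_conv`).

## References

* O. Regev, *On lattices, learning with errors, random linear codes, and cryptography*, J. ACM 56 (2009),
  Lemma 4.1 (proof, re-randomising the secret) and Lemma 3.7 (proof, adding noise). [RegevLWE2009]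
* Z. Brakerski, A. Langlois, C. Peikert, O. Regev, D. Stehlé, *Classical hardness of learning with errors*,
  STOC 2013; arXiv:1306.0281, Lemma 2.15 and §4 (binary to uniform secret). [BrakerskiEtAl2013]
-/

noncomputable section

open MeasureTheory ProbabilityTheory
open scoped Real ENNReal NNReal

namespace Literature.Computability.Cryptography

namespace BLPRS2013

section Post

variable (n q : ℕ) [NeZero q] (τ : ℝ) (t : Fin n → ZMod q)

/-- The phase `⟨a, t⟩/q ∈ 𝕋` added by the random self-reduction. [cite: RegevLWE2009, Lemma 4.1 (proof)] -/
def rsrPhase (a : Fin n → ZMod q) : UnitAddCircle := ((((a ⬝ᵥ t).val : ℝ) / q : ℝ) : UnitAddCircle)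

/-- **The post-processing kernel**: `(a, b) ↦ (a, b + ⟨a, t⟩/q + e)`, `e ← Ψ_τ`. [cite: RegevLWE2009, Lemma 4.1 (proof) and Lemma 3.7 (proof)] -/
def postKernel (p : (Fin n → ZMod q) × UnitAddCircle) : Measure ((Fin n → ZMod q) × UnitAddCircle) :=
  (LWE.wrappedGaussian τ).map fun e => (p.1, p.2 + rsrPhase n q t p.1 + e)

/-- The action of the kernel on a law of torus samples. [folklore] -/
def postOutput (μ : Measure ((Fin n → ZMod q) × UnitAddCircle)) : Measure ((Fin n → ZMod q) × UnitAddCircle) :=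
  μ.bind (postKernel n q τ t)

variable {n q τ t}

omit [NeZero q] in
/-- Measurability of `e ↦ (a, c + e)`. [folklore] -/
theorem measurable_mk_const_add (a : Fin n → ZMod q) (c : UnitAddCircle) : Measurable fun e : UnitAddCircle => (a, c + e) :=
  measurable_const.prodMk (measurable_const.add measurable_id)

omit [NeZero q] in
/-- The kernel on a measurable set. [folklore] -/
theorem postKernel_apply (p : (Fin n → ZMod q) × UnitAddCircle) {S : Set ((Fin n → ZMod q) × UnitAddCircle)} (hS : MeasurableSet S) :
    postKernel n q τ t p S = LWE.wrappedGaussian τ {e | (p.1, p.2 + rsrPhase n q t p.1 + e) ∈ S} := by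
  rw [postKernel, Measure.map_apply (measurable_mk_const_add _ _) hS]
  rfl

/-- The kernel is Markov. [folklore] -/
instance isProbabilityMeasure_postKernel (p : (Fin n → ZMod q) × UnitAddCircle) : IsProbabilityMeasure (postKernel n q τ t p) :=
  Measure.isProbabilityMeasure_map (measurable_mk_const_add _ _).aemeasurable

/-- The kernel is measurable. [folklore] -/
theorem measurable_postKernel : Measurable (postKernel n q τ t) := by
  refine Measure.measurable_of_measurable_coe _ fun S hS => ?_
  simp_rw [postKernel_apply _ hS]
  refine measurable_from_prod_countable_right fun a => ?_
  dsimp only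
  -- `b ↦ Ψ_τ {e | (a, b + c + e) ∈ S}` is the section measure of a measurable set in `𝕋 × 𝕋`
  have hT : MeasurableSet {x : UnitAddCircle × UnitAddCircle | (a, x.1 + rsrPhase n q t a + x.2) ∈ S} :=
    (measurable_const.prodMk ((measurable_fst.add measurable_const).add measurable_snd)) hS
  exact measurable_measure_prodMk_left hT

/-- The output of a probability law is a probability law. [folklore] -/
instance isProbabilityMeasure_postOutput (μ : Measure ((Fin n → ZMod q) × UnitAddCircle)) [IsProbabilityMeasure μ] :
    IsProbabilityMeasure (postOutput n q τ t μ) := by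
  constructor
  rw [postOutput, Measure.bind_apply MeasurableSet.univ measurable_postKernel.aemeasurable]
  simp

/-- The output law of a product input `U(ℤ_qⁿ) ⊗ φ` pushed through `(a, y) ↦ (a, g a + y)`, on a measurable
set: `∑_a U(a) · ∫∫ 1_S(a, g a + y + ⟨a,t⟩/q + e) dΨ_τ(e) dφ(y)`. [folklore] -/
theorem postOutput_map_apply (φ : Measure UnitAddCircle) [SFinite φ] (g : (Fin n → ZMod q) → UnitAddCircle)
    {S : Set ((Fin n → ZMod q) × UnitAddCircle)} (hS : MeasurableSet S) :
    postOutput n q τ t (((PMF.uniformOfFintype (Fin n → ZMod q)).toMeasure.prod φ).map fun p => (p.1, g p.1 + p.2)) S =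
      ∑ a : Fin n → ZMod q, PMF.uniformOfFintype (Fin n → ZMod q) a *
        ∫⁻ y, LWE.wrappedGaussian τ {e | (a, g a + y + rsrPhase n q t a + e) ∈ S} ∂φ := by
  have hG : Measurable fun p : (Fin n → ZMod q) × UnitAddCircle => (p.1, g p.1 + p.2) :=
    measurable_from_prod_countable_right fun a => by dsimp only; exact measurable_const.prodMk (measurable_const.add measurable_id)
  have hmeas : Measurable fun x => postKernel n q τ t x S := (Measure.measurable_coe hS).comp measurable_postKernel
  have hmeas' : Measurable fun a : (Fin n → ZMod q) × UnitAddCircle => postKernel n q τ t (a.1, g a.1 + a.2) S := hmeas.comp hG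
  rw [postOutput, Measure.bind_apply hS measurable_postKernel.aemeasurable, lintegral_map hmeas hG,
    lintegral_prod _ hmeas'.aemeasurable, lintegral_fintype]
  refine Finset.sum_congr rfl fun a _ => ?_
  rw [PMF.toMeasure_apply_singleton _ _ (measurableSet_singleton _), mul_comm]
  congr 1
  refine lintegral_congr fun y => ?_
  rw [postKernel_apply _ hS]

/-- **Uniform samples stay uniform** (Haar measure on `𝕋` is invariant under the translation by
`⟨a,t⟩/q + e`, then average over `e`). [cite: RegevLWE2009, Lemma 4.1 (proof)] -/
theorem postOutput_uniformInput : postOutput n q τ t (uniformInput n q) = uniformInput n q := by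
  have hid : uniformInput n q = ((PMF.uniformOfFintype (Fin n → ZMod q)).toMeasure.prod (volume : Measure UnitAddCircle)).map
      fun p => (p.1, (fun _ => (0 : UnitAddCircle)) p.1 + p.2) := by
    have : (fun p : (Fin n → ZMod q) × UnitAddCircle => (p.1, (fun _ => (0 : UnitAddCircle)) p.1 + p.2)) = id := by
      funext p; simp
    rw [this, Measure.map_id]; rfl
  ext S hS
  rw [hid, postOutput_map_apply (volume : Measure UnitAddCircle) (fun _ => (0 : UnitAddCircle)) hS, ← hid, uniformInput, Measure.prod_apply hS,
    lintegral_fintype]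
  refine Finset.sum_congr rfl fun a _ => ?_
  rw [PMF.toMeasure_apply_singleton _ _ (measurableSet_singleton _), mul_comm (volume (Prod.mk a ⁻¹' S))]
  congr 1
  -- `∫ Ψ_τ{e | (a, y + c + e) ∈ S} dy = ∫∫ 1 dΨ_τ dy` after the Haar-preserving change `y ↦ y + c + e`
  have hsec : MeasurableSet (Prod.mk a ⁻¹' S) := measurable_prodMk_left hS
  have hT : MeasurableSet {x : UnitAddCircle × UnitAddCircle | (a, x.1 + rsrPhase n q t a + x.2) ∈ S} :=
    (measurable_const.prodMk ((measurable_fst.add measurable_const).add measurable_snd)) hS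
  calc ∫⁻ y, LWE.wrappedGaussian τ {e | (a, (0 : UnitAddCircle) + y + rsrPhase n q t a + e) ∈ S} ∂(volume : Measure UnitAddCircle)
      = ∫⁻ y, LWE.wrappedGaussian τ {e | (a, y + rsrPhase n q t a + e) ∈ S} ∂(volume : Measure UnitAddCircle) := by simp_rw [zero_add]
    _ = (volume.prod (LWE.wrappedGaussian τ)) {x : UnitAddCircle × UnitAddCircle | (a, x.1 + rsrPhase n q t a + x.2) ∈ S} := by
        rw [Measure.prod_apply hT]; rfl
    _ = ((LWE.wrappedGaussian τ).prod volume) {x : UnitAddCircle × UnitAddCircle | (a, x.2 + rsrPhase n q t a + x.1) ∈ S} := by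
        rw [← Measure.prod_swap, Measure.map_apply measurable_swap hT]; rfl
    _ = ∫⁻ e, volume {y : UnitAddCircle | (a, y + rsrPhase n q t a + e) ∈ S} ∂LWE.wrappedGaussian τ := by
        rw [Measure.prod_apply]
        · rfl
        · exact (measurable_const.prodMk ((measurable_snd.add measurable_const).add measurable_fst)) hS
    _ = ∫⁻ _e, volume (Prod.mk a ⁻¹' S) ∂LWE.wrappedGaussian τ := by
        refine lintegral_congr fun e => ?_
        have : {y : UnitAddCircle | (a, y + rsrPhase n q t a + e) ∈ S} = (fun y => y + (rsrPhase n q t a + e)) ⁻¹' (Prod.mk a ⁻¹' S) := by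
          ext y; simp [add_assoc]
        rw [this, ← Measure.map_apply (measurable_add_const _) hsec, map_add_right_eq_self]
    _ = volume (Prod.mk a ⁻¹' S) := by
        rw [lintegral_const, measure_univ, mul_one]

/-- **Phases add mod 1**: `⟨a,s⟩/q + ⟨a,t⟩/q ≡ ⟨a,s+t⟩/q (mod 1)`. [folklore] -/
theorem phase_add_rsrPhase (s : Fin n → ZMod q) (a : Fin n → ZMod q) :
    (((((a ⬝ᵥ s).val : ℝ) / q : ℝ) : UnitAddCircle)) + rsrPhase n q t a = ((((a ⬝ᵥ (s + t)).val : ℝ) / q : ℝ) : UnitAddCircle) := by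
  have hq : (q : ℝ) ≠ 0 := by exact_mod_cast NeZero.ne q
  have hdvd : (q : ℤ) ∣ (((a ⬝ᵥ s).val : ℤ) + ((a ⬝ᵥ t).val : ℤ) - ((a ⬝ᵥ (s + t)).val : ℤ)) := by
    rw [← ZMod.intCast_zmod_eq_zero_iff_dvd]
    push_cast
    rw [ZMod.natCast_zmod_val, ZMod.natCast_zmod_val, ZMod.natCast_zmod_val, dotProduct_add]
    ring
  obtain ⟨j, hj⟩ := hdvd
  rw [rsrPhase, ← QuotientAddGroup.mk_add, QuotientAddGroup.eq_iff_sub_mem]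
  refine ⟨j, ?_⟩
  have hj' : (((a ⬝ᵥ s).val : ℝ) + ((a ⬝ᵥ t).val : ℝ) - ((a ⬝ᵥ (s + t)).val : ℝ)) = (q : ℝ) * j := by exact_mod_cast hj
  simp only [zsmul_eq_mul, mul_one]
  field_simp
  linarith

/-- **`A_{q,s,Ψ_σ} ↦ A_{q,s+t,Ψ_{√(σ²+τ²)}}` exactly.** [cite: RegevLWE2009, Lemma 4.1 (proof) and Lemma 3.7 (proof); BrakerskiEtAl2013, Lemma 2.15] -/
theorem postOutput_torusLWESample (σ : ℝ) (s : Fin n → ZMod q) :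
    postOutput n q τ t (LWE.torusLWESample q (LWE.wrappedGaussian σ) s) =
      LWE.torusLWESample q (LWE.wrappedGaussian (Real.sqrt (σ ^ 2 + τ ^ 2))) (s + t) := by
  -- both sample maps are of the form `(a, y) ↦ (a, g a + y)`
  have hform : ∀ s' : Fin n → ZMod q, LWE.torusSampleMap q s' = fun p : (Fin n → ZMod q) × UnitAddCircle =>
      (p.1, (fun a => (((((a ⬝ᵥ s').val : ℝ) / q : ℝ) : UnitAddCircle))) p.1 + p.2) := fun s' => rfl
  have hG : ∀ s' : Fin n → ZMod q, Measurable fun p : (Fin n → ZMod q) × UnitAddCircle =>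
      (p.1, (fun a => (((((a ⬝ᵥ s').val : ℝ) / q : ℝ) : UnitAddCircle))) p.1 + p.2) := fun s' =>
    measurable_from_prod_countable_right fun a => by dsimp only; exact measurable_const.prodMk (measurable_const_add _)
  ext S hS
  rw [LWE.torusLWESample, hform s,
    postOutput_map_apply (LWE.wrappedGaussian σ) (fun a => (((((a ⬝ᵥ s).val : ℝ) / q : ℝ) : UnitAddCircle))) hS,
    LWE.torusLWESample, hform (s + t), Measure.map_apply (hG _) hS, Measure.prod_apply ((hG _) hS), lintegral_fintype]
  refine Finset.sum_congr rfl fun a _ => ?_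
  rw [PMF.toMeasure_apply_singleton _ _ (measurableSet_singleton _), mul_comm]
  congr 1
  -- the new noise law is the convolution
  have hsec : MeasurableSet {u : UnitAddCircle | (a, ((((a ⬝ᵥ (s + t)).val : ℝ) / q : ℝ) : UnitAddCircle) + u) ∈ S} :=
    (measurable_const.prodMk (measurable_const_add _)) hS
  rw [← LWE.wrappedGaussian_conv, show Prod.mk a ⁻¹' ((fun p : (Fin n → ZMod q) × UnitAddCircle =>
      (p.1, (fun a => ((((a ⬝ᵥ (s + t)).val : ℝ) / q : ℝ) : UnitAddCircle)) p.1 + p.2)) ⁻¹' S) =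
      {u : UnitAddCircle | (a, ((((a ⬝ᵥ (s + t)).val : ℝ) / q : ℝ) : UnitAddCircle) + u) ∈ S} from rfl,
    Measure.conv, Measure.map_apply measurable_add hsec, Measure.prod_apply (measurable_add hsec)]
  refine lintegral_congr fun y => ?_
  congr 1
  ext e
  simp only [Set.mem_setOf_eq, Set.mem_preimage]
  rw [← phase_add_rsrPhase s a, add_add_add_comm, add_assoc]

end Post

end BLPRS2013

end Literature.Computability.Cryptography

end
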